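/-
Copyright: the b2b-balaban T⁴-continuum CRUX team, row NE7b OWNER lineage `t4-ne7b-p1` (gen 140). Project licence.
-/
import Summits.QuantumFields.BalabanUV.T4Continuum.Spine.NE7b.SupBlockFirstOrderLetters
import Literature.Probability.Distributions.GaussianLinearCompensation

/-!
# WHITENED FIRST-ORDER LETTERS (SCOPING (d11)(3) ANSWERED BY A CHANGE OF VARIABLES): the Dobrushin route of (440)–(455) asked the
# PRECISION `M = Γ⁻¹` of the fluctuation Gaussian to dominate the input kernel row by row — a condition that FAILS for block-spin
# precisions (`−Δ + κP`: the comparison matrix is indefinite) and is not even stated for the road's SINGULAR finite-range covariances.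
# WHITENING removes it: write `Γ = A·Aᵀ` (`A : ι × κ`, any `κ`; `A` rectangular, `Γ` possibly singular) and `ω = Aξ` with `ξ ∼ N(0, I_κ)`.
# In the `ξ`-coordinates the precision IS the identity (no off-diagonal entries at all), and the perturbation `Ũ(ξ) = U(Aξ + ψ)` has
#   cross letters   `|∂_{ξ_w}∂_{ξ_x}Ũ| ≤ Σ_{u,v} |A_{uw}|·|A_{vx}|·Hk_{vu}`      (`Hk` an entrywise majorant of `U″`),
#   diagonal letter `lamA ≥ Σ_{u,v} |A_{ux}|·|A_{vx}|·Hk_{vu}`,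
# and the gradient components `F_v(ξ) = U′(Aξ+ψ)(e_v)` (`v ∈ ι`) have `ξ`-Lipschitz vectors `w ↦ Σ_u |A_{uw}|·Hk_{vu}`; all four have
# row∕column letters `αc·hr·αr`, `αc·hc·αr`, `hr·αr`, `αc·hc` in the letters `αr, αc` (rows∕columns of `|A|`) and `hr, hc` (rows∕columns
# of `Hk`).  Dobrushin's condition in whitened coordinates is therefore PURE SMALLNESS, `αc·hr·αr ≤ γ(1 − lamA)`, `γ < 1` — the kernel
# analogue of the regulator, with no condition on `Γ` beyond the letters of its factor `A` (row NE7b, node U5c; (451) `line_clm_hasDerivAt`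
# and `Literature.Probability.Distributions.matrixCLM` BY NAME; [folklore])

Cell `pub-balaban`, sub-cell `t4`, spine estimate NE7b (`T4WeightBudget.RelWeightBound`; the cell's OWN estimate — NOT PRINTED in
[Bałaban 1983–89], NOT PROVED).  Crux-route work under `Spine/NE7b/` by the row OWNER (`t4-ne7b-p1` gen 140, file (456)) under FREEZE
(0)'s crux-prover clause; NOTHING of Bałaban's is named as a Lean object, valued or asserted; no `T4Continuum/Support` leaf typed; no
`def`, no notation (the whitening map is the Literature CLM `matrixCLM A`; every letter is WRITTEN OUT as a finite sum); zero `sorry`.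
Imports (BY NAME): the OWNER's (451) `…SupBlockFirstOrderLetters` (`line_clm_hasDerivAt`), `Literature.Probability.Distributions.
GaussianLinearCompensation` (`matrixCLM`, `ofLp_matrixCLM`).

WHAT IS PROVED ([folklore]; `A : Matrix ι κ ℝ`, `T = matrixCLM A : ℝ^κ →L ℝ^ι`, `U ∈ C²` with `U′, U″`, majorant `|U″(φ)[e_z][e_x]| ≤ Hk_{xz}`):
* §1 `matrixCLM_single_apply` (`(T e_w)_u = A_{uw}`), `whitened_line` (`T(ξ + r•e_w) + ψ = (Tξ + ψ) + r•T e_w`), `toLp_update_zero`.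
* §2 `expand_first_slot₂`, `expand_two_slots` (`B h k = Σ_{u,v} h_u k_v B e_u e_v`), `first_slot_majorant`, `two_slot_majorant`.
* §3 the whitened potential: `whitened_hasFDerivAt` (`Ũ′(ξ) = U′(Tξ+ψ) ∘ T`), **`whitened_cross`**, **`whitened_ceiling`**, **`whitened_floor`**
  (the three first-order letters of (449)∕(450) for `Ũ` along the `ξ`-coordinate directions).
* §4 the observables: **`whitened_obs_lipschitz`** (shift format) and **`whitened_obs_lipVec`** ((447)'s `update` format).
* §5 the letters: `whitened_cross_rowsum_le` (`≤ αc·hr·αr`), `whitened_cross_colsum_le` (`≤ αc·hc·αr`), `whitened_J_rowsum_le`∕`colsum_le`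
  (Dobrushin's `J` with the identity precision), `whitened_obs_rowsum_le` (`≤ hr·αr`), `whitened_obs_colsum_le` (`≤ αc·hc`).
* §6 toy: `Fin 1`, `A = 1`: `(T e_0)_0 = 1`.

HONEST (what this is NOT).  Letters only: the covariance kernel letter in whitened coordinates ((447) on `ℝ^κ` with precision `I`, the
pushforward `N(0,I)∘A⁻¹ = N(0,AAᵀ)`) is (457); the moment letters and the output Hessian letters are (458)∕(459); the choice of the
factor `A` for the road's fluctuation covariance (finite-range pieces `Γ = Σ_j A_jA_jᵀ` give a rectangular `A = [A_1|…|A_k]`) and ITS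
letters `αr, αc` are inputs.  Third-order kernel letters ((d11)(4)) are NOT touched.  Scalar skeleton ((A3), NC-NE7b-α UNRULED); nothing of
Bałaban's asserted.  BY-NAME EFFECT ON THE WALL: NONE.  NE7b NOT PRINTED ∕ NOT PROVED; spine PROVED 0∕9; rung (B)+1 — the programme's
measures remain FINITE-torus statements; NOT the mass gap, NOT Clay.  HONEST DEPENDENCY: continuum YM on T⁴ ⇐ BetaPertH ∧ nine spine
estimates (0∕9 proved); BetaPertH ⇐ (D1) ∧ (D4) ∧ CAP+tail; G-an2-4 gates asym, D1 and NE2∕3∕4.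
-/

set_option autoImplicit false

noncomputable section

namespace Summit.QuantumFields.BalabanUV.T4Continuum.NE7b.SupWhitenedFirstOrderLetters

open Real Set Finset Matrix Function
open scoped BigOperators
open Literature.Probability.Distributions (matrixCLM ofLp_matrixCLM)
open SupBlockFirstOrderLetters (line_clm_hasDerivAt)

variable {ι κ : Type} [Fintype ι] [DecidableEq ι] [Fintype κ] [DecidableEq κ]

variable {U : EuclideanSpace ℝ ι → ℝ} {U' : EuclideanSpace ℝ ι → EuclideanSpace ℝ ι →L[ℝ] ℝ}
  {U'' : EuclideanSpace ℝ ι → EuclideanSpace ℝ ι →L[ℝ] EuclideanSpace ℝ ι →L[ℝ] ℝ} {Hk : ι → ι → ℝ} {A : Matrix ι κ ℝ} {αr αc hr hc lamA : ℝ}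

/-! ## §1. The whitening map on coordinate vectors and lines -/

omit [DecidableEq ι] in
/-- **`(T e_w)_u = A_{uw}`** for `T = matrixCLM A`. [folklore] -/
theorem matrixCLM_single_apply (A : Matrix ι κ ℝ) (w : κ) (u : ι) :
    matrixCLM A (EuclideanSpace.single w (1 : ℝ)) u = A u w := by
  have e : WithLp.ofLp (EuclideanSpace.single w (1 : ℝ) : EuclideanSpace ℝ κ) = Pi.single w (1 : ℝ) := rfl
  have h : WithLp.ofLp (matrixCLM A (EuclideanSpace.single w (1 : ℝ))) u = A u w := by
    rw [ofLp_matrixCLM, e, mulVec_single_one, Matrix.col_apply]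
  exact h

omit [Fintype ι] [DecidableEq ι] [Fintype κ] [DecidableEq κ] in
/-- **The whitened line**: `T(ξ + r•h) + ψ = (Tξ + ψ) + r•Th` for any continuous linear `T`. [folklore] -/
theorem whitened_line (T : EuclideanSpace ℝ κ →L[ℝ] EuclideanSpace ℝ ι) (ψ : EuclideanSpace ℝ ι) (ξ h : EuclideanSpace ℝ κ) (r : ℝ) :
    T (ξ + r • h) + ψ = (T ξ + ψ) + r • T h := by
  rw [map_add, map_smul]
  abel

omit [Fintype κ] in
/-- **The coordinate line in `ℝ^κ`**: `toLp(z^{w,s}) = toLp(z^{w,t}) + (s − t)•e_w`. [folklore] -/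
theorem toLp_update_zero (z : κ → ℝ) (w : κ) (s t : ℝ) :
    (WithLp.toLp 2 (update z w s) : EuclideanSpace ℝ κ) = WithLp.toLp 2 (update z w t) + (s - t) • EuclideanSpace.single w (1 : ℝ) := by
  have he : EuclideanSpace.single w (1 : ℝ) = WithLp.toLp 2 (Pi.single w (1 : ℝ)) := rfl
  have hu : ∀ r : ℝ, update z w r = z + (r - z w) • Pi.single w (1 : ℝ) := fun r => by
    funext i
    by_cases h : i = w
    · subst h; simp
    · simp [h]
  rw [hu s, hu t, WithLp.toLp_add, WithLp.toLp_add, WithLp.toLp_smul, WithLp.toLp_smul, ← he]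
  module

/-! ## §2. Expansion of a bilinear form in the coordinate basis and entrywise majorants -/

/-- The coordinate expansion `h = Σ_u h_u•e_u`. [folklore] -/
theorem eq_sum_single (h : EuclideanSpace ℝ ι) : h = ∑ u, h u • EuclideanSpace.single u (1 : ℝ) := by
  have e := (EuclideanSpace.basisFun ι ℝ).sum_repr h
  simp only [EuclideanSpace.basisFun_repr, EuclideanSpace.basisFun_apply] at e
  exact e.symm

/-- **First-slot expansion**: `B h k = Σ_u h_u·B e_u k`. [folklore] -/
theorem expand_first_slot₂ (B : EuclideanSpace ℝ ι →L[ℝ] EuclideanSpace ℝ ι →L[ℝ] ℝ) (h k : EuclideanSpace ℝ ι) :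
    B h k = ∑ u, h u * B (EuclideanSpace.single u (1 : ℝ)) k := by
  conv_lhs => rw [eq_sum_single h]
  simp only [map_sum, map_smul, _root_.sum_apply, _root_.smul_apply, smul_eq_mul]

/-- **Two-slot expansion**: `B h k = Σ_u Σ_v h_u·k_v·B e_u e_v`. [folklore] -/
theorem expand_two_slots (B : EuclideanSpace ℝ ι →L[ℝ] EuclideanSpace ℝ ι →L[ℝ] ℝ) (h k : EuclideanSpace ℝ ι) :
    B h k = ∑ u, ∑ v, h u * k v * B (EuclideanSpace.single u (1 : ℝ)) (EuclideanSpace.single v (1 : ℝ)) := by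
  rw [expand_first_slot₂ B h k]
  refine Finset.sum_congr rfl fun u _ => ?_
  have e : B (EuclideanSpace.single u (1 : ℝ)) k = ∑ v, k v * B (EuclideanSpace.single u (1 : ℝ)) (EuclideanSpace.single v (1 : ℝ)) := by
    conv_lhs => rw [eq_sum_single k]
    simp only [map_sum, map_smul, smul_eq_mul]
  rw [e, Finset.mul_sum]
  exact Finset.sum_congr rfl fun v _ => by ring

/-- **First-slot majorant**: `|B e_u e_v| ≤ Hk_{vu}` for all `u` ⟹ `|B h e_v| ≤ Σ_u |h_u|·Hk_{vu}`. [folklore] -/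
theorem first_slot_majorant (B : EuclideanSpace ℝ ι →L[ℝ] EuclideanSpace ℝ ι →L[ℝ] ℝ) (v : ι)
    (hB : ∀ u, |B (EuclideanSpace.single u (1 : ℝ)) (EuclideanSpace.single v (1 : ℝ))| ≤ Hk v u) (h : EuclideanSpace ℝ ι) :
    |B h (EuclideanSpace.single v (1 : ℝ))| ≤ ∑ u, |h u| * Hk v u := by
  rw [expand_first_slot₂ B h]
  refine (Finset.abs_sum_le_sum_abs _ _).trans (Finset.sum_le_sum fun u _ => ?_)
  rw [abs_mul]
  exact mul_le_mul_of_nonneg_left (hB u) (abs_nonneg _)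

/-- **Two-slot majorant**: `|B e_u e_v| ≤ Hk_{vu}` ⟹ `|B h k| ≤ Σ_u Σ_v |h_u|·|k_v|·Hk_{vu}`. [folklore] -/
theorem two_slot_majorant (B : EuclideanSpace ℝ ι →L[ℝ] EuclideanSpace ℝ ι →L[ℝ] ℝ)
    (hB : ∀ u v, |B (EuclideanSpace.single u (1 : ℝ)) (EuclideanSpace.single v (1 : ℝ))| ≤ Hk v u) (h k : EuclideanSpace ℝ ι) :
    |B h k| ≤ ∑ u, ∑ v, |h u| * |k v| * Hk v u := by
  rw [expand_two_slots B h k]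
  refine (Finset.abs_sum_le_sum_abs _ _).trans (Finset.sum_le_sum fun u _ => ?_)
  refine (Finset.abs_sum_le_sum_abs _ _).trans (Finset.sum_le_sum fun v _ => ?_)
  rw [abs_mul, abs_mul]
  exact mul_le_mul_of_nonneg_left (hB u v) (mul_nonneg (abs_nonneg _) (abs_nonneg _))

/-! ## §3. The whitened potential `Ũ(ξ) = U(Tξ + ψ)` and its first-order letters -/

omit [DecidableEq ι] in
/-- **`Ũ ∈ C¹` with `Ũ′(ξ) = U′(Tξ + ψ) ∘ T`** (chain rule). [folklore] -/
theorem whitened_hasFDerivAt (hUd : ∀ φ : EuclideanSpace ℝ ι, HasFDerivAt U (U' φ) φ) (A : Matrix ι κ ℝ) (ψ : EuclideanSpace ℝ ι)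
    (ξ : EuclideanSpace ℝ κ) :
    HasFDerivAt (fun ξ : EuclideanSpace ℝ κ => U (matrixCLM A ξ + ψ)) ((U' (matrixCLM A ξ + ψ)).comp (matrixCLM A)) ξ := by
  have hl : HasFDerivAt (fun ξ : EuclideanSpace ℝ κ => matrixCLM A ξ + ψ) (matrixCLM A) ξ :=
    (matrixCLM A).hasFDerivAt.add_const ψ
  exact (hUd (matrixCLM A ξ + ψ)).comp ξ hl

omit [DecidableEq ι] in
/-- **`Ũ′` is `C¹`** when `U′` is: `HasFDerivAt (ξ ↦ U′(Tξ+ψ) ∘ T) (((compL).flip T) ∘L U″(Tξ+ψ) ∘L T) ξ`; only CONTINUITY of `Ũ′` is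
used downstream, recorded here in the weaker form `Continuous`. [folklore] -/
theorem whitened_deriv_continuous (hU'd : ∀ φ : EuclideanSpace ℝ ι, HasFDerivAt U' (U'' φ) φ) (A : Matrix ι κ ℝ) (ψ : EuclideanSpace ℝ ι) :
    Continuous fun ξ : EuclideanSpace ℝ κ => (U' (matrixCLM A ξ + ψ)).comp (matrixCLM A) := by
  have hU'c : Continuous U' := continuous_iff_continuousAt.2 fun φ => (hU'd φ).continuousAt
  have h1 : Continuous fun ξ : EuclideanSpace ℝ κ => U' (matrixCLM A ξ + ψ) := hU'c.comp (by fun_prop)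
  exact ((ContinuousLinearMap.compL ℝ (EuclideanSpace ℝ κ) (EuclideanSpace ℝ ι) ℝ).flip (matrixCLM A)).continuous.comp h1

/-- **THE WHITENED CROSS LETTER**: `|(Ũ′(ξ + r•e_w) − Ũ′(ξ))(e_x)| ≤ (Σ_u Σ_v |A_{uw}|·|A_{vx}|·Hk_{vu})·|r|` (mean value theorem along
`s ↦ U′(φ + s•Te_w)(Te_x)`, two-slot majorant). [folklore] -/
theorem whitened_cross (hU'd : ∀ φ : EuclideanSpace ℝ ι, HasFDerivAt U' (U'' φ) φ)
    (hHk : ∀ (φ : EuclideanSpace ℝ ι) (x z : ι), |U'' φ (EuclideanSpace.single z (1 : ℝ)) (EuclideanSpace.single x (1 : ℝ))| ≤ Hk x z)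
    (A : Matrix ι κ ℝ) (ψ : EuclideanSpace ℝ ι) (x w : κ) (ξ : EuclideanSpace ℝ κ) (r : ℝ) :
    |(U' (matrixCLM A (ξ + r • EuclideanSpace.single w (1 : ℝ)) + ψ)).comp (matrixCLM A) (EuclideanSpace.single x (1 : ℝ)) -
        (U' (matrixCLM A ξ + ψ)).comp (matrixCLM A) (EuclideanSpace.single x (1 : ℝ))| ≤ (∑ u, ∑ v, |A u w| * |A v x| * Hk v u) * |r| := by
  rw [ContinuousLinearMap.comp_apply, ContinuousLinearMap.comp_apply, whitened_line]
  set φ : EuclideanSpace ℝ ι := matrixCLM A ξ + ψ with hφ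
  have hd : ∀ s ∈ (univ : Set ℝ), HasDerivWithinAt (fun s : ℝ => U' (φ + s • matrixCLM A (EuclideanSpace.single w (1 : ℝ)))
      (matrixCLM A (EuclideanSpace.single x (1 : ℝ))))
      (U'' (φ + s • matrixCLM A (EuclideanSpace.single w (1 : ℝ))) (matrixCLM A (EuclideanSpace.single w (1 : ℝ)))
        (matrixCLM A (EuclideanSpace.single x (1 : ℝ)))) univ s :=
    fun s _ => (line_clm_hasDerivAt hU'd φ _ _ s).hasDerivWithinAt
  have hb : ∀ s ∈ (univ : Set ℝ), ‖U'' (φ + s • matrixCLM A (EuclideanSpace.single w (1 : ℝ))) (matrixCLM A (EuclideanSpace.single w (1 : ℝ)))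
      (matrixCLM A (EuclideanSpace.single x (1 : ℝ)))‖ ≤ ∑ u, ∑ v, |A u w| * |A v x| * Hk v u := fun s _ => by
    rw [Real.norm_eq_abs]
    have h := two_slot_majorant (Hk := Hk) (U'' (φ + s • matrixCLM A (EuclideanSpace.single w (1 : ℝ))))
      (fun u v => hHk (φ + s • matrixCLM A (EuclideanSpace.single w (1 : ℝ))) v u)
      (matrixCLM A (EuclideanSpace.single w (1 : ℝ))) (matrixCLM A (EuclideanSpace.single x (1 : ℝ)))
    simpa only [matrixCLM_single_apply] using h
  have h := convex_univ.norm_image_sub_le_of_norm_hasDerivWithin_le hd hb (mem_univ 0) (mem_univ r)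
  simp only [zero_smul, add_zero, sub_zero, Real.norm_eq_abs] at h
  exact h

/-- **THE WHITENED DIAGONAL CEILING**: `|(Ũ′(ξ + r•e_x) − Ũ′(ξ))(e_x)| ≤ lamA·|r|` once `Σ_u Σ_v |A_{ux}|·|A_{vx}|·Hk_{vu} ≤ lamA`. [folklore] -/
theorem whitened_ceiling (hU'd : ∀ φ : EuclideanSpace ℝ ι, HasFDerivAt U' (U'' φ) φ)
    (hHk : ∀ (φ : EuclideanSpace ℝ ι) (x z : ι), |U'' φ (EuclideanSpace.single z (1 : ℝ)) (EuclideanSpace.single x (1 : ℝ))| ≤ Hk x z)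
    (A : Matrix ι κ ℝ) (hlam : ∀ x : κ, ∑ u, ∑ v, |A u x| * |A v x| * Hk v u ≤ lamA) (ψ : EuclideanSpace ℝ ι) (x : κ)
    (ξ : EuclideanSpace ℝ κ) (r : ℝ) :
    |(U' (matrixCLM A (ξ + r • EuclideanSpace.single x (1 : ℝ)) + ψ)).comp (matrixCLM A) (EuclideanSpace.single x (1 : ℝ)) -
        (U' (matrixCLM A ξ + ψ)).comp (matrixCLM A) (EuclideanSpace.single x (1 : ℝ))| ≤ lamA * |r| :=
  (whitened_cross hU'd hHk A ψ x x ξ r).trans (mul_le_mul_of_nonneg_right (hlam x) (abs_nonneg r))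

/-- **THE WHITENED DIAGONAL FLOOR**: `−lamA·r² ≤ (Ũ′(ξ + r•e_x) − Ũ′(ξ))(e_x)·r`. [folklore] -/
theorem whitened_floor (hU'd : ∀ φ : EuclideanSpace ℝ ι, HasFDerivAt U' (U'' φ) φ)
    (hHk : ∀ (φ : EuclideanSpace ℝ ι) (x z : ι), |U'' φ (EuclideanSpace.single z (1 : ℝ)) (EuclideanSpace.single x (1 : ℝ))| ≤ Hk x z)
    (A : Matrix ι κ ℝ) (hlam : ∀ x : κ, ∑ u, ∑ v, |A u x| * |A v x| * Hk v u ≤ lamA) (ψ : EuclideanSpace ℝ ι) (x : κ)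
    (ξ : EuclideanSpace ℝ κ) (r : ℝ) :
    -lamA * r ^ 2 ≤ ((U' (matrixCLM A (ξ + r • EuclideanSpace.single x (1 : ℝ)) + ψ)).comp (matrixCLM A) (EuclideanSpace.single x (1 : ℝ)) -
        (U' (matrixCLM A ξ + ψ)).comp (matrixCLM A) (EuclideanSpace.single x (1 : ℝ))) * r := by
  have h := whitened_ceiling hU'd hHk A hlam ψ x ξ r
  set d : ℝ := (U' (matrixCLM A (ξ + r • EuclideanSpace.single x (1 : ℝ)) + ψ)).comp (matrixCLM A) (EuclideanSpace.single x (1 : ℝ)) -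
        (U' (matrixCLM A ξ + ψ)).comp (matrixCLM A) (EuclideanSpace.single x (1 : ℝ)) with hd
  have h1 := neg_abs_le (d * r)
  rw [abs_mul] at h1
  have h2 : |d| * |r| ≤ lamA * |r| * |r| := mul_le_mul_of_nonneg_right h (abs_nonneg r)
  rw [mul_assoc, abs_mul_abs_self] at h2
  nlinarith [h1, h2, sq_abs r]

/-! ## §4. The observables `F_v(ξ) = U′(Tξ + ψ)(e_v)` -/

/-- **The gradient components are `ξ`-Lipschitz** (shift format): `|U′(T(ξ + r•e_w) + ψ)(e_v) − U′(Tξ + ψ)(e_v)| ≤ (Σ_u |A_{uw}|·Hk_{vu})·|r|`.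
[folklore] -/
theorem whitened_obs_lipschitz (hU'd : ∀ φ : EuclideanSpace ℝ ι, HasFDerivAt U' (U'' φ) φ)
    (hHk : ∀ (φ : EuclideanSpace ℝ ι) (x z : ι), |U'' φ (EuclideanSpace.single z (1 : ℝ)) (EuclideanSpace.single x (1 : ℝ))| ≤ Hk x z)
    (A : Matrix ι κ ℝ) (ψ : EuclideanSpace ℝ ι) (v : ι) (w : κ) (ξ : EuclideanSpace ℝ κ) (r : ℝ) :
    |U' (matrixCLM A (ξ + r • EuclideanSpace.single w (1 : ℝ)) + ψ) (EuclideanSpace.single v (1 : ℝ)) -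
        U' (matrixCLM A ξ + ψ) (EuclideanSpace.single v (1 : ℝ))| ≤ (∑ u, |A u w| * Hk v u) * |r| := by
  rw [whitened_line]
  set φ : EuclideanSpace ℝ ι := matrixCLM A ξ + ψ with hφ
  have hd : ∀ s ∈ (univ : Set ℝ), HasDerivWithinAt (fun s : ℝ => U' (φ + s • matrixCLM A (EuclideanSpace.single w (1 : ℝ)))
      (EuclideanSpace.single v (1 : ℝ)))
      (U'' (φ + s • matrixCLM A (EuclideanSpace.single w (1 : ℝ))) (matrixCLM A (EuclideanSpace.single w (1 : ℝ))) (EuclideanSpace.single v (1 : ℝ)))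
        univ s :=
    fun s _ => (line_clm_hasDerivAt hU'd φ _ _ s).hasDerivWithinAt
  have hb : ∀ s ∈ (univ : Set ℝ), ‖U'' (φ + s • matrixCLM A (EuclideanSpace.single w (1 : ℝ))) (matrixCLM A (EuclideanSpace.single w (1 : ℝ)))
      (EuclideanSpace.single v (1 : ℝ))‖ ≤ ∑ u, |A u w| * Hk v u := fun s _ => by
    rw [Real.norm_eq_abs]
    have h := first_slot_majorant (Hk := Hk) (U'' (φ + s • matrixCLM A (EuclideanSpace.single w (1 : ℝ)))) v
      (fun u => hHk (φ + s • matrixCLM A (EuclideanSpace.single w (1 : ℝ))) v u)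
      (matrixCLM A (EuclideanSpace.single w (1 : ℝ)))
    simpa only [matrixCLM_single_apply] using h
  have h := convex_univ.norm_image_sub_le_of_norm_hasDerivWithin_le hd hb (mem_univ 0) (mem_univ r)
  simp only [zero_smul, add_zero, sub_zero, Real.norm_eq_abs] at h
  exact h

/-- **The gradient components in (447)'s `update` format**: for `z : κ → ℝ`,
`|U′(T toLp(z^{w,s}) + ψ)(e_v) − U′(T toLp(z^{w,t}) + ψ)(e_v)| ≤ (Σ_u |A_{uw}|·Hk_{vu})·|s − t|`. [folklore] -/
theorem whitened_obs_lipVec (hU'd : ∀ φ : EuclideanSpace ℝ ι, HasFDerivAt U' (U'' φ) φ)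
    (hHk : ∀ (φ : EuclideanSpace ℝ ι) (x z : ι), |U'' φ (EuclideanSpace.single z (1 : ℝ)) (EuclideanSpace.single x (1 : ℝ))| ≤ Hk x z)
    (A : Matrix ι κ ℝ) (ψ : EuclideanSpace ℝ ι) (v : ι) (w : κ) (z : κ → ℝ) (s t : ℝ) :
    |U' (matrixCLM A (WithLp.toLp 2 (update z w s)) + ψ) (EuclideanSpace.single v (1 : ℝ)) -
        U' (matrixCLM A (WithLp.toLp 2 (update z w t)) + ψ) (EuclideanSpace.single v (1 : ℝ))| ≤ (∑ u, |A u w| * Hk v u) * |s - t| := by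
  rw [toLp_update_zero z w s t]
  exact whitened_obs_lipschitz hU'd hHk A ψ v w _ (s - t)

/-- **The whitened potential's letters in (449)'s shift format with `U` replaced by `Ũ`**: the cross letter for the pair `(x, w)` read
through `toLp`, as (449) `tilted_cross` consumes it (recorded for the successor's convenience). [folklore] -/
theorem whitened_cross_toLp (hU'd : ∀ φ : EuclideanSpace ℝ ι, HasFDerivAt U' (U'' φ) φ)
    (hHk : ∀ (φ : EuclideanSpace ℝ ι) (x z : ι), |U'' φ (EuclideanSpace.single z (1 : ℝ)) (EuclideanSpace.single x (1 : ℝ))| ≤ Hk x z)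
    (A : Matrix ι κ ℝ) (ψ : EuclideanSpace ℝ ι) (x w : κ) (η : EuclideanSpace ℝ κ) (r : ℝ) :
    |(U' (matrixCLM A (η + r • EuclideanSpace.single w (1 : ℝ) + 0) + ψ)).comp (matrixCLM A) (EuclideanSpace.single x (1 : ℝ)) -
        (U' (matrixCLM A (η + 0) + ψ)).comp (matrixCLM A) (EuclideanSpace.single x (1 : ℝ))| ≤ (∑ u, ∑ v, |A u w| * |A v x| * Hk v u) * |r| := by
  simpa only [add_zero] using whitened_cross hU'd hHk A ψ x w η r

/-! ## §5. The letters -/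

omit [DecidableEq ι] [DecidableEq κ] in
/-- **Row letter of the whitened cross majorant**: `Σ_w Σ_u Σ_v |A_{uw}|·|A_{vx}|·Hk_{vu} ≤ αc·hr·αr` (`ι` inhabited). [folklore] -/
theorem whitened_cross_rowsum_le [Nonempty ι] (hHk0 : ∀ v u, 0 ≤ Hk v u) (hαr : ∀ u, ∑ w, |A u w| ≤ αr) (hαc : ∀ w, ∑ u, |A u w| ≤ αc)
    (hhr : ∀ v, ∑ u, Hk v u ≤ hr) (x : κ) : ∑ w, ∑ u, ∑ v, |A u w| * |A v x| * Hk v u ≤ αc * hr * αr := by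
  obtain ⟨u₀⟩ := ‹Nonempty ι›
  have hαr0 : 0 ≤ αr := (Finset.sum_nonneg fun w _ => abs_nonneg (A u₀ w)).trans (hαr u₀)
  have hhr0 : 0 ≤ hr := (Finset.sum_nonneg fun u _ => hHk0 u₀ u).trans (hhr u₀)
  have e : ∑ v, |A v x| * ∑ u, Hk v u * ∑ w, |A u w| = ∑ v, ∑ u, ∑ w, |A u w| * |A v x| * Hk v u := by
    refine Finset.sum_congr rfl fun v _ => ?_
    rw [Finset.mul_sum]
    refine Finset.sum_congr rfl fun u _ => ?_
    rw [Finset.mul_sum, Finset.mul_sum]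
    exact Finset.sum_congr rfl fun w _ => by ring
  calc ∑ w, ∑ u, ∑ v, |A u w| * |A v x| * Hk v u = ∑ u, ∑ w, ∑ v, |A u w| * |A v x| * Hk v u := Finset.sum_comm
    _ = ∑ u, ∑ v, ∑ w, |A u w| * |A v x| * Hk v u := Finset.sum_congr rfl fun u _ => Finset.sum_comm
    _ = ∑ v, ∑ u, ∑ w, |A u w| * |A v x| * Hk v u := Finset.sum_comm
    _ = ∑ v, |A v x| * ∑ u, Hk v u * ∑ w, |A u w| := e.symm
    _ ≤ ∑ v, |A v x| * ∑ u, Hk v u * αr := Finset.sum_le_sum fun v _ => mul_le_mul_of_nonneg_left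
        (Finset.sum_le_sum fun u _ => mul_le_mul_of_nonneg_left (hαr u) (hHk0 v u)) (abs_nonneg _)
    _ ≤ ∑ v, |A v x| * (hr * αr) := Finset.sum_le_sum fun v _ => mul_le_mul_of_nonneg_left
        (by rw [← Finset.sum_mul]; exact mul_le_mul_of_nonneg_right (hhr v) hαr0) (abs_nonneg _)
    _ ≤ αc * (hr * αr) := by rw [← Finset.sum_mul]; exact mul_le_mul_of_nonneg_right (hαc x) (mul_nonneg hhr0 hαr0)
    _ = αc * hr * αr := by ring

omit [DecidableEq ι] [DecidableEq κ] in
/-- **Column letter of the whitened cross majorant**: `Σ_x Σ_u Σ_v |A_{uw}|·|A_{vx}|·Hk_{vu} ≤ αc·hc·αr`. [folklore] -/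
theorem whitened_cross_colsum_le [Nonempty ι] (hHk0 : ∀ v u, 0 ≤ Hk v u) (hαr : ∀ u, ∑ w, |A u w| ≤ αr) (hαc : ∀ w, ∑ u, |A u w| ≤ αc)
    (hhc : ∀ u, ∑ v, Hk v u ≤ hc) (w : κ) : ∑ x, ∑ u, ∑ v, |A u w| * |A v x| * Hk v u ≤ αc * hc * αr := by
  obtain ⟨u₀⟩ := ‹Nonempty ι›
  have hαr0 : 0 ≤ αr := (Finset.sum_nonneg fun w _ => abs_nonneg (A u₀ w)).trans (hαr u₀)
  have hhc0 : 0 ≤ hc := (Finset.sum_nonneg fun v _ => hHk0 v u₀).trans (hhc u₀)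
  have e : ∑ u, |A u w| * ∑ v, Hk v u * ∑ x, |A v x| = ∑ u, ∑ v, ∑ x, |A u w| * |A v x| * Hk v u := by
    refine Finset.sum_congr rfl fun u _ => ?_
    rw [Finset.mul_sum]
    refine Finset.sum_congr rfl fun v _ => ?_
    rw [Finset.mul_sum, Finset.mul_sum]
    exact Finset.sum_congr rfl fun x _ => by ring
  calc ∑ x, ∑ u, ∑ v, |A u w| * |A v x| * Hk v u = ∑ u, ∑ x, ∑ v, |A u w| * |A v x| * Hk v u := Finset.sum_comm
    _ = ∑ u, ∑ v, ∑ x, |A u w| * |A v x| * Hk v u := Finset.sum_congr rfl fun u _ => Finset.sum_comm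
    _ = ∑ u, |A u w| * ∑ v, Hk v u * ∑ x, |A v x| := e.symm
    _ ≤ ∑ u, |A u w| * ∑ v, Hk v u * αr := Finset.sum_le_sum fun u _ => mul_le_mul_of_nonneg_left
        (Finset.sum_le_sum fun v _ => mul_le_mul_of_nonneg_left (hαr v) (hHk0 v u)) (abs_nonneg _)
    _ ≤ ∑ u, |A u w| * (hc * αr) := Finset.sum_le_sum fun u _ => mul_le_mul_of_nonneg_left
        (by rw [← Finset.sum_mul]; exact mul_le_mul_of_nonneg_right (hhc u) hαr0) (abs_nonneg _)
    _ ≤ αc * (hc * αr) := by rw [← Finset.sum_mul]; exact mul_le_mul_of_nonneg_right (hαc w) (mul_nonneg hhc0 hαr0)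
    _ = αc * hc * αr := by ring

omit [DecidableEq ι] [Fintype κ] [DecidableEq κ] in
/-- The whitened cross majorant is nonnegative. [folklore] -/
theorem whitened_cross_nonneg (hHk0 : ∀ v u, 0 ≤ Hk v u) (A : Matrix ι κ ℝ) (x w : κ) : 0 ≤ ∑ u, ∑ v, |A u w| * |A v x| * Hk v u :=
  Finset.sum_nonneg fun u _ => Finset.sum_nonneg fun v _ => mul_nonneg (mul_nonneg (abs_nonneg _) (abs_nonneg _)) (hHk0 v u)

omit [DecidableEq ι] in
/-- **Dobrushin's `J` in whitened coordinates, rows**: the precision is the identity, so `J_{xw} = |1_{xw}| + HA_{xw}` off the diagonal is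
just `HA_{xw}`, and `Σ_w J_{xw} ≤ αc·hr·αr`. [folklore] -/
theorem whitened_J_rowsum_le [Nonempty ι] (hHk0 : ∀ v u, 0 ≤ Hk v u) (hαr : ∀ u, ∑ w, |A u w| ≤ αr) (hαc : ∀ w, ∑ u, |A u w| ≤ αc)
    (hhr : ∀ v, ∑ u, Hk v u ≤ hr) (x : κ) :
    ∑ w, (if w = x then 0 else |(1 : Matrix κ κ ℝ) x w| + ∑ u, ∑ v, |A u w| * |A v x| * Hk v u) ≤ αc * hr * αr := by
  refine le_trans (Finset.sum_le_sum fun w _ => ?_) (whitened_cross_rowsum_le hHk0 hαr hαc hhr x)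
  split_ifs with h
  · exact whitened_cross_nonneg hHk0 A x w
  · rw [Matrix.one_apply_ne (fun e => h e.symm), abs_zero, zero_add]

omit [DecidableEq ι] in
/-- **Dobrushin's `J` in whitened coordinates, columns**: `Σ_x J_{xw} ≤ αc·hc·αr`. [folklore] -/
theorem whitened_J_colsum_le [Nonempty ι] (hHk0 : ∀ v u, 0 ≤ Hk v u) (hαr : ∀ u, ∑ w, |A u w| ≤ αr) (hαc : ∀ w, ∑ u, |A u w| ≤ αc)
    (hhc : ∀ u, ∑ v, Hk v u ≤ hc) (w : κ) :
    ∑ x, (if w = x then 0 else |(1 : Matrix κ κ ℝ) x w| + ∑ u, ∑ v, |A u w| * |A v x| * Hk v u) ≤ αc * hc * αr := by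
  refine le_trans (Finset.sum_le_sum fun x _ => ?_) (whitened_cross_colsum_le hHk0 hαr hαc hhc w)
  split_ifs with h
  · exact whitened_cross_nonneg hHk0 A x w
  · rw [Matrix.one_apply_ne (fun e => h e.symm), abs_zero, zero_add]

omit [DecidableEq ι] [Fintype κ] [DecidableEq κ] in
/-- The observables' vectors are nonnegative. [folklore] -/
theorem whitened_obs_nonneg (hHk0 : ∀ v u, 0 ≤ Hk v u) (A : Matrix ι κ ℝ) (v : ι) (w : κ) : 0 ≤ ∑ u, |A u w| * Hk v u :=
  Finset.sum_nonneg fun u _ => mul_nonneg (abs_nonneg _) (hHk0 v u)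

omit [DecidableEq ι] [DecidableEq κ] in
/-- **Row letter of the observables' vectors** (the total Lipschitz mass of `F_v`): `Σ_w Σ_u |A_{uw}|·Hk_{vu} ≤ hr·αr`. [folklore] -/
theorem whitened_obs_rowsum_le (hHk0 : ∀ v u, 0 ≤ Hk v u) (hαr : ∀ u, ∑ w, |A u w| ≤ αr) (hhr : ∀ v, ∑ u, Hk v u ≤ hr) (v : ι) :
    ∑ w, ∑ u, |A u w| * Hk v u ≤ hr * αr := by
  have hαr0 : 0 ≤ αr := (Finset.sum_nonneg fun w _ => abs_nonneg (A v w)).trans (hαr v)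
  calc ∑ w, ∑ u, |A u w| * Hk v u = ∑ u, Hk v u * ∑ w, |A u w| := by
        rw [Finset.sum_comm]
        exact Finset.sum_congr rfl fun u _ => by rw [Finset.mul_sum]; exact Finset.sum_congr rfl fun w _ => by ring
    _ ≤ ∑ u, Hk v u * αr := Finset.sum_le_sum fun u _ => mul_le_mul_of_nonneg_left (hαr u) (hHk0 v u)
    _ ≤ hr * αr := by rw [← Finset.sum_mul]; exact mul_le_mul_of_nonneg_right (hhr v) hαr0

omit [DecidableEq ι] [Fintype κ] [DecidableEq κ] in
/-- **Column letter of the observables' vectors** (summable columns of the family `F_v`, `v ∈ ι`): `Σ_v Σ_u |A_{uw}|·Hk_{vu} ≤ αc·hc`.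
[folklore] -/
theorem whitened_obs_colsum_le [Nonempty ι] (hHk0 : ∀ v u, 0 ≤ Hk v u) (hαc : ∀ w, ∑ u, |A u w| ≤ αc) (hhc : ∀ u, ∑ v, Hk v u ≤ hc)
    (w : κ) : ∑ v, ∑ u, |A u w| * Hk v u ≤ αc * hc := by
  obtain ⟨u₀⟩ := ‹Nonempty ι›
  have hhc0 : 0 ≤ hc := (Finset.sum_nonneg fun v _ => hHk0 v u₀).trans (hhc u₀)
  calc ∑ v, ∑ u, |A u w| * Hk v u = ∑ u, |A u w| * ∑ v, Hk v u := by
        rw [Finset.sum_comm]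
        exact Finset.sum_congr rfl fun u _ => by rw [Finset.mul_sum]
    _ ≤ ∑ u, |A u w| * hc := Finset.sum_le_sum fun u _ => mul_le_mul_of_nonneg_left (hhc u) (abs_nonneg _)
    _ ≤ αc * hc := by rw [← Finset.sum_mul]; exact mul_le_mul_of_nonneg_right (hαc w) hhc0

/-! ## §6. Toy instance (kernel) -/

/-- Toy: on `Fin 1` with `A = 1`, the whitening map fixes the coordinate vector: `(T e_0)_0 = 1`. -/
example : matrixCLM (1 : Matrix (Fin 1) (Fin 1) ℝ) (EuclideanSpace.single (0 : Fin 1) (1 : ℝ)) 0 = 1 := by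
  rw [matrixCLM_single_apply, Matrix.one_apply_eq]

end Summit.QuantumFields.BalabanUV.T4Continuum.NE7b.SupWhitenedFirstOrderLetters

end
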